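import Summits.AtomisticToContinuum.Crystallization.Theorems.PricedLinkCensusLocalToGlobalFold
import Summits.AtomisticToContinuum.Crystallization.Theorems.PricedLinkCensusLocalToGlobalReduction

/-!
# Line `flux-cell-joint-census` — skeleton for crux `PricedLinkCensus.LocalToGlobal`
# (item stmt-AtomisticToContinuum-14232; lead prover, revision 6)

Crux (fixed, the route's): `LocalToGlobal : TruncatedCensusGap → ChargedEnergyGap`.

Revision 6 (lead c4, 2026-08-16): RESHAPED TO THE MINIMAL OPEN STUB.  Revisions 3–5 carried the one open stub
`stub_fluxCellPricedGap : FccMirrorExact → FluxCellPricedGap`, which is equivalent to `FluxCellPricedGap`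
(`stub_fluxCellPricedGap_iff`, tree `Theorems/PricedLinkCensusLocalToGlobalReduction.lean`) and STRICTLY STRONGER
than what the composition needs: it implies the sibling crux `ChargedEnergyGap` (stmt-AtomisticToContinuum-14231)
outright (`chargedEnergyGap_of_fluxCellPricedGap`, p114594) — a priced gap for a LOCAL functional `Σᵢ λᵢ ≤ E_LJ`.
Four leads (0, c1, c2, c3) and triage r1-1/2/3 found it crux-14231-sized and not reshapeable inside the line, and
found the antecedent `TruncatedCensusGap` unconsumable (crux workfile `Disproof.lean` D1/BN2/D2/§4; `NOTES.md`
§c2 linear certificates, §c4.1 quantitative vacuity: on Lennard-Jones near-minimisers the census bound reads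
`#charged/N ≤ δ₀/κ_T ≈ 18`, and on their best dilate it is blind below the charged fraction `m_χ/κ_T ≈ 4.4 %`;
§c4.2: every potential split `E_LJ ≥ A + B`, `A ≤ E_χ`, `B ≤ E_W`, loses a volume term ≥ m_χ·N at the minimiser).
A stub must never be stronger than the composition requires, so revision 6 registers as the ONE open stub the
exact residue — the statement of `ChargedEnergyGap` VERBATIM (item stmt-AtomisticToContinuum-14231, which has
its own lead chain) — and closes the crux through the landed fold `localToGlobal_of_chargedEnergyGap`
(`Theorems/PricedLinkCensusLocalToGlobalFold.lean`, p116082).  The line's landed content is unchanged and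
remains the certified route INTO that stub: `stub_newtonShell8` (p87299), `stub_confinedThomson` (p94894),
`stub_fccMirrorExact` (p113939), the localisation `Σᵢ λᵢ ≤ E_LJ` (`sum_siteFunctional_le_interactionEnergy'`)
and `localToGlobal_of_fluxCellPricedGap : FluxCellPricedGap → LocalToGlobal` (p114594, tree).  The stub is discharged the day 14231 closes (import
its deciding theorem; `exact` it), or becomes moot the day 14230 is refuted (`localToGlobal_of_not_truncatedCensusGap`,
`Disproof.lean` §1).  wave: none — 1 stub left, and it is another crux's statement (never briefed to a worker
from here).

Revision 5 (lead c2) / 4 (lead c1): Lean content of revision 3, re-registered.  Revision 3 (lead 0, after wave 1):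
THREE OF FOUR STUBS LANDED — `stub_newtonShell8` p87299, `stub_confinedThomson` p94894, `stub_fccMirrorExact`
p113939; vocabulary and composition in `Theorems/PricedLinkCensusLocalToGlobalDefs.lean` (p84962); unconditional
reduction in `Theorems/PricedLinkCensusLocalToGlobalReduction.lean` (p114594).

THE LINE (idea card `Ideas/flux-cell-joint-census.md`; line card `Lines/flux-cell-joint-census.md`).  `r⁻⁶` on
`ℝ³` is the Newton kernel of `ℝ⁸`.  Smearing each particle into the uniform unit charge on the 8-ball
`B(ι yᵢ, nnᵢ/2)` is exact for pair terms (NewtonShell8, PROVED); Thomson's principle with the flux of each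
charge confined to the tube over its truncated strict Voronoi cell and wall flux prescribed by a square-integrable
transfer field bounds the 8-D Coulomb energy (ConfinedThomson, PROVED): `E_LJ ≥ Σᵢ λᵢ` for the pinned site
functionals.  The census for `λ` (`FluxCellPricedGap`) implies `ChargedEnergyGap`; pure confinement is exact at
fcc (`FccMirrorExact`, PROVED).  What is left is the energetic crystallization of Lennard-Jones in `d = 3` with
defect pricing — the sibling crux — and THAT is the registered stub below.
-/

noncomputable section

open Summit.AtomisticToContinuum.Crystallization.Theses.PricedLinkCensus
open Summit.AtomisticToContinuum.Crystallization.Theorems.PricedLinkCensusLocalToGlobal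

namespace Summit.AtomisticToContinuum.Crystallization.Cruxes.LocalToGlobal.FluxCellJointCensus

/-! ## The one registered stub (revision 6): the sibling crux, verbatim -/

/-- STUB (the only open one; crux-sized BY NAME: this is the statement of the sibling crux `ChargedEnergyGap`,
item stmt-AtomisticToContinuum-14231, VERBATIM — the priced Lennard-Jones energy gap
`N·e* + κ·#charged(1/100) − C·N^{2/3} ≤ E_LJ(y)` for every injective `y`).  It is exactly what the composition
needs (`localToGlobal_of_chargedEnergyGap`) and nothing more; the line's own local form `FluxCellPricedGap`
implies it (`chargedEnergyGap_of_fluxCellPricedGap`, p114594).  Held, not delegated: it is owned by 14231's lead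
chain; discharge by importing 14231's deciding theorem when it lands. -/
theorem stub_chargedEnergyGap :
    ∃ κ C : ℝ, 0 < κ ∧ ∀ (N : ℕ) (y : Fin N → EuclideanSpace ℝ (Fin 3)), Function.Injective y → (N : ℝ) * (⨅ Q : Literature.MathematicalPhysics.StatisticalMechanics.PeriodicConfiguration 3, Q.energyPerParticle Literature.MathematicalPhysics.StatisticalMechanics.lennardJones) + κ * (Nat.card {i : Fin N // ¬ Literature.Geometry.DiscreteGeometry.IsChargeFree (1 / 100 : ℝ) y i} : ℝ) - C * (N : ℝ) ^ (2 / 3 : ℝ) ≤ Literature.MathematicalPhysics.StatisticalMechanics.interactionEnergy Literature.MathematicalPhysics.StatisticalMechanics.lennardJones y := by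
  sorry

/-! ## The composition: the stub proves the crux BY NAME -/

/-- **Skeleton theorem** (the one `#h21_check_skeleton` audits): the crux `LocalToGlobal` BY NAME from the one
open stub through the landed fold `localToGlobal_of_chargedEnergyGap` (p116082); `sorry` occurs only inside
`stub_chargedEnergyGap`. -/
theorem LocalToGlobal_of : LocalToGlobal :=
  localToGlobal_of_chargedEnergyGap stub_chargedEnergyGap

end Summit.AtomisticToContinuum.Crystallization.Cruxes.LocalToGlobal.FluxCellJointCensus

end
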